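import Mathlib
import HarnessLib

/-!
# Haution 2012, Proposition 12: the Todd–index bound `v_p(n_X) ≤ [dim X/(p−1)] + v_p(χ(𝒪_X))` in dimension `< p(p−1)`

Topic `Literature/AlgebraicGeometry/KTheory` (integrality of the homological Chern character,
Riemann–Roch without denominators, index of a variety).  Grounding by-product of route
`ResolutionOfSingularities/ToddIndex` (crux `NotToddIndexBound` = stmt-ResolutionOfSingularities-18202,
crux `ResolutionToToddIndex` = stmt-ResolutionOfSingularities-18203), whose SCHEME-FREE vocabulary
(Hilbert function of `k[x₀,…,x_N]/I`, Hilbert polynomial, degrees of field extensions carrying a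
zero of `I`) is reused verbatim below, so that the fact can be quoted against the route's
`bound p k N I` (see `Haution2012_prop12_routeShape`).

## Source, as printed

O. Haution, *Integrality of the Chern character in small codimension*, Adv. Math. 231 (2012)
855–878 = arXiv:1103.4084 [Haution2011] (held; read 2026-08-17; arXiv page numbers).

* p. 4, Notations: "We fix a base field `k`. A variety is a finite type, separated,
  quasi-projective scheme over `k`."  p. 15: "We fix a prime number `p`. When `X` is a projective
  variety, we let `n_X` be the positive generator of the image of the degree map `CH(X) → ℤ`"
  (= gcd of the degrees `[κ(x):k]` of the closed points of `X`), "`χ(𝒪_X) = Σ_j (−1)^j dim_k H^j(X, 𝒪_X)`";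
  `[α]` = integer part.
* p. 5, **Statement 1** (`p`-integrality in codimension `≤ c`: `v_p(ch_{d−n}(x)) ≥ −[n/(p−1)]` for
  `x ∈ K₀'(X)_{(d)}`, `n ≤ c`); p. 7, **Theorem 2.1.** "`p`-integrality holds in codimension
  `≤ p(p−1)−1`."  (any base field); p. 8, **Theorem 3.1** (base field of characteristic `≠ p`:
  all codimensions, from Gabber's prime-to-`p` regular alterations); p. 5: "We expect that this
  assumption is superfluous" — the **Conjecture** of the introduction (p. 3), OPEN when
  `char k = p` and the codimension is `≥ p(p−1)`.
* p. 8, **Proposition 3.** `X` a local complete intersection variety ⇒ `τ_n · ch_{dim X−n}[𝒪_X]`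
  is integral for every `n` (`τ_d = ∏_ℓ ℓ^{[d/(ℓ−1)]}`, the `d`-th Todd number).
* p. 16, **Proposition 12.** "Let `X` be a projective variety of dimension `< p(p−1)`. Then
  `v_p(n_X) ≤ [dim X/(p−1)] + v_p(χ(𝒪_X))`."  Proof (5 lines): Theorem 2.1 gives an integral
  zero-cycle `x` and `λ` prime to `p` with `x = λ·p^{[dim X/(p−1)]}·ch₀[𝒪_X]`; take degrees:
  `n_X ∣ λ·p^{[dim X/(p−1)]}·χ(𝒪_X)`.
* Companion (orientation only, nothing vendored from it): O. Haution, *Degree formula for the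
  Euler characteristic*, Proc. Amer. Math. Soc. 141 (2013) 1863–1869 = arXiv:1103.4076
  [Haution2013DegreeEuler]: Lemma 3 ([Zai-09]; smooth projective `X` has a zero-cycle of degree
  `τ_{dim X}·χ(𝒪_X)`), §4.2 "When resolution of singularities is available, one can obtain
  (Lemma 3) … for singular `X`", §4.3 "A statement of Rost [Ros-On-08] says that for any projective
  variety `X` over a perfect field of positive characteristic `p`, one has `v_p(n_X) ≤ v_p(χ(𝒪_X))`."
  Hence a violator of the bound at `p = char k`, if any, is a non-lci projective variety of
  dimension `≥ p(p−1)` over an IMPERFECT field admitting no regular alteration of degree prime to `p`.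

## Rendering (scheme-free)

Fix a field `k` (ANY characteristic — Proposition 12 does not assume `char k = p`) and a
homogeneous prime ideal `I ⊂ k[x₀,…,x_N]`; `X = Proj(k[x]/I)` is an integral projective variety and
every integral projective `k`-variety is of this form.
* `projHilbertFunction k N I m = dim_k (k[x]/I)_m`; `IsHilbertPolynomial k N I P` ⇔ `P ∈ ℚ[T]` agrees
  with it for `m ≫ 0` (then `P` is unique, `P.natDegree = dim X` for `X ≠ ∅`, and
  `P(0) = χ(X, 𝒪_X)` since `(k[x]/I)_m = H⁰(X, 𝒪_X(m))` and `H^{>0}(X, 𝒪_X(m)) = 0` for `m ≫ 0`).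
* `IndexDvd k N I q` ⇔ `q ∣ [L:k]` for every finite extension `L/k` over which `I` has a non-zero
  zero ⇔ `q ∣ n_X` (a closed point `x` has the `κ(x)`-rational zero above it, and an `L`-valued zero
  lies over a closed point `x` with `κ(x) ⊆ L`).
* `ToddIndexBoundAt p k N I P` ⇔ for every `v` with `p^v ∣ n_X`, `p^{[dim X/(p−1)]}·χ(𝒪_X) ∈ p^v ℤ`
  ⇔ `v_p(n_X) ≤ [dim X/(p−1)] + v_p(χ(𝒪_X))` (both sides trivial when `χ(𝒪_X) = 0`, `v_p(0) = ∞`).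
  Degenerate case `I = (x₀,…,x_N)` (`X = ∅`): `P = 0` and the bound holds with `c = 0`.
With these, Proposition 12 reads exactly as `Haution2012_prop12` (restricted to integral `X`:
faithful-or-weaker).  The route's `bound p k N I` is `∀ P, IsHilbertPolynomial → ToddIndexBoundAt`
WITHOUT the dimension restriction, at `p = char k`; its crux `NotToddIndexBound` asserts a violator
for some prime `p` — i.e. the negation of Haution's Conjecture specialised to `x = [𝒪_X]`,
`n = dim X`; by this fact such a violator has `dim X ≥ p(p−1)`.

## Contents (namespace `Literature.AlgebraicGeometry.KTheory`)

* vocabulary `projHilbertFunction`, `IsElementwiseHomogeneous`, `IsHilbertPolynomial`, `IndexDvd`,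
  `ToddIndexBoundAt` (defs, verbatim the `let`s of the route file);
* `Haution2012_prop12` — Proposition 12 (named fact, `def … : Prop`);
* `Haution2012_prop12_routeShape` — the fact restated with the route file's inlined `let`
  vocabulary at `p = char k` (proved by `rfl`-unfolding: certifies the vocabularies agree);
* `indexDvd_one` — sanity lemma.

## References

* [Haution2011] O. Haution, Adv. Math. 231 (2012) 855–878, arXiv:1103.4084 — Statement 1 (p. 5),
  Thm 2.1 (p. 7), Prop. 3 and Thm 3.1 (p. 8), Prop. 12 (p. 16).
* [Haution2013DegreeEuler] O. Haution, Proc. Amer. Math. Soc. 141 (2013) 1863–1869, arXiv:1103.4076 —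
  Lemma 3, §4.2, §4.3.
* [Fulton1998] W. Fulton, *Intersection Theory*, Ch. 18 (Riemann–Roch for singular varieties).
-/

noncomputable section

namespace Literature.AlgebraicGeometry.KTheory

/-- Hilbert function of the homogeneous coordinate ring: `m ↦ dim_k (k[x₀,…,x_N]/I)_m`, the image of
the degree-`m` homogeneous summand in the quotient (verbatim the route's `hilb`). [folklore] -/
def projHilbertFunction (k : Type) [Field k] (N : ℕ) (I : Ideal (MvPolynomial (Fin (N + 1)) k))
    (m : ℕ) : ℕ :=
  Module.finrank k (Submodule.map (Ideal.Quotient.mkₐ k I).toLinearMap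
    (MvPolynomial.homogeneousSubmodule (Fin (N + 1)) k m))

/-- `I` is a homogeneous ideal, elementwise form: every homogeneous component of every member of
`I` lies in `I` (verbatim the route's `homog`). [folklore] -/
def IsElementwiseHomogeneous (k : Type) [Field k] (N : ℕ)
    (I : Ideal (MvPolynomial (Fin (N + 1)) k)) : Prop :=
  ∀ f ∈ I, ∀ n : ℕ, MvPolynomial.homogeneousComponent n f ∈ I

/-- `P ∈ ℚ[T]` is the Hilbert polynomial of `k[x]/I`: it agrees with the Hilbert function for all
large `m`. [folklore] -/
def IsHilbertPolynomial (k : Type) [Field k] (N : ℕ) (I : Ideal (MvPolynomial (Fin (N + 1)) k))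
    (P : Polynomial ℚ) : Prop :=
  ∀ᶠ m : ℕ in Filter.atTop, P.eval (m : ℚ) = (projHilbertFunction k N I m : ℚ)

/-- `q` divides the index of `Proj(k[x]/I)`: `q ∣ [L:k]` for every finite extension `L/k` over
which `I` has a non-zero zero (verbatim the route's `pdeg`). [folklore] -/
def IndexDvd (k : Type) [Field k] (N : ℕ) (I : Ideal (MvPolynomial (Fin (N + 1)) k))
    (q : ℕ) : Prop :=
  ∀ (L : Type) [Field L] [Algebra k L] [FiniteDimensional k L],
    (∃ a : Fin (N + 1) → L, a ≠ 0 ∧ ∀ f ∈ I, MvPolynomial.aeval a f = 0) → q ∣ Module.finrank k L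

/-- The Todd–index bound at the prime `p` for `X = Proj(k[x]/I)` with Hilbert polynomial `P`:
for every `v` with `p^v ∣ n_X`, `p^{[deg P/(p−1)]}·P(0)` is `p^v` times an integer, i.e.
`v_p(n_X) ≤ [dim X/(p−1)] + v_p(χ(𝒪_X))` (verbatim the body of the route's `bound`). [folklore] -/
def ToddIndexBoundAt (p : ℕ) (k : Type) [Field k] (N : ℕ)
    (I : Ideal (MvPolynomial (Fin (N + 1)) k)) (P : Polynomial ℚ) : Prop :=
  ∀ v : ℕ, IndexDvd k N I (p ^ v) →
    ∃ c : ℤ, (p : ℚ) ^ (P.natDegree / (p - 1)) * P.eval 0 = (p : ℚ) ^ v * (c : ℚ)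

/-- **Haution 2012, Proposition 12 (Todd–index bound in small dimension).** "Let `X` be a
projective variety of dimension `< p(p−1)`. Then `v_p(n_X) ≤ [dim X/(p−1)] + v_p(χ(𝒪_X))`."
Here `p` is any prime and the base field `k` is arbitrary (no assumption on `char k`); rendered for
integral `X = Proj(k[x₀,…,x_N]/I)`, `I` a homogeneous prime, with `dim X = deg P` and
`χ(𝒪_X) = P(0)` for the Hilbert polynomial `P` (see the module docstring).  Consequence of
Theorem 2.1 (`p`-integrality of the homological Chern character in codimension `≤ p(p−1)−1`).
Grounds `Summit.ResolutionOfSingularities.ResolutionOfSingularities.Theses.ToddIndex.NotToddIndexBound`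
(a violator must have `deg P ≥ p(p−1)`) and `…ToddIndex.ResolutionToToddIndex` (the bound's
printed form). [cite: Haution2011, Proposition 12 (p. 16); Theorem 2.1 (p. 7)] -/
def Haution2012_prop12 : Prop :=
  ∀ p : ℕ, p.Prime →
    ∀ (k : Type) [Field k] (N : ℕ) (I : Ideal (MvPolynomial (Fin (N + 1)) k)),
      I.IsPrime → IsElementwiseHomogeneous k N I →
      ∀ P : Polynomial ℚ, IsHilbertPolynomial k N I P → P.natDegree < p * (p - 1) →
        ToddIndexBoundAt p k N I P

/-- Sanity: `1` divides every index. [folklore] -/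
theorem indexDvd_one (k : Type) [Field k] (N : ℕ) (I : Ideal (MvPolynomial (Fin (N + 1)) k)) :
    IndexDvd k N I 1 := by
  intro L _ _ _ _
  exact one_dvd _

/-- Proposition 12 in the SHAPE of the route file `Summits/…/Theses/ToddIndex.lean` (its `let`
vocabulary inlined, at `p = char k`): the named fact gives the route's `bound p k N I` for every
Hilbert polynomial of degree `< p(p−1)`.  Proved by unfolding — certifies that the vocabularies
agree definitionally. [folklore] -/
theorem Haution2012_prop12_routeShape (h : Haution2012_prop12) (p : ℕ) (hp : p.Prime)
    (k : Type) [Field k] [CharP k p] (N : ℕ) (I : Ideal (MvPolynomial (Fin (N + 1)) k))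
    (hI : I.IsPrime) (hhom : ∀ f ∈ I, ∀ n : ℕ, MvPolynomial.homogeneousComponent n f ∈ I)
    (P : Polynomial ℚ)
    (hP : ∀ᶠ m : ℕ in Filter.atTop, P.eval (m : ℚ) =
      (Module.finrank k (Submodule.map (Ideal.Quotient.mkₐ k I).toLinearMap
        (MvPolynomial.homogeneousSubmodule (Fin (N + 1)) k m)) : ℚ))
    (hdim : P.natDegree < p * (p - 1)) (v : ℕ)
    (hv : ∀ (L : Type) [Field L] [Algebra k L] [FiniteDimensional k L],
      (∃ a : Fin (N + 1) → L, a ≠ 0 ∧ ∀ f ∈ I, MvPolynomial.aeval a f = 0) →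
        p ^ v ∣ Module.finrank k L) :
    ∃ c : ℤ, (p : ℚ) ^ (P.natDegree / (p - 1)) * P.eval 0 = (p : ℚ) ^ v * (c : ℚ) :=
  h p hp k N I hI hhom P hP hdim v hv

end Literature.AlgebraicGeometry.KTheory

end
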